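import Summits.BirchSwinnertonDyer.Rank1Residual.Ordinary.Conjectures.KolyvaginKimDatumOfEulerSystemLetter
import Summits.BirchSwinnertonDyer.Rank1Residual.GaloisImage.KolyvaginSystemOfEulerSystemPropagatedBad
import HarnessLib

/-!
# The Kolyvagin-class datum and C-16's per-letter clause from an EULER SYSTEM of `T_pE` on the rows WITH ANOMALOUS BAD PLACES
# (THEOREM D″ — n1011's `…PropagatedBad` variant — ∘ F30; theorems only; nothing asserted; C-16 stays a CONJECTURE)

HONEST FRAMING (cell `b2b-bsdres`, run/shared/lean/b2b/bsd-rank1-residual/, verbatim in every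
file): the goal of the cell is to DELETE the COMBINATION-SHAPED residual classes of the
Birch–Swinnerton-Dyer formula for ALL analytic-rank `≤ 1` elliptic curves over `ℚ` — "full BSD
formula for every rank `≤ 1` curve in class `C`" assembled STRICTLY from published theorems — so
that the rank-`≤ 1` remainder becomes exactly the CONSTRUCTION-SHAPED classes, which are TYPED
(missing-input `Prop`s), NOT attempted. This is not "finishing BSD". Seat `b2b-bsdres-additive-p3`
(X8 prover B / X7 joint; typer-designate for the cell conjecture C-16 = hyp C120.1; ladder BSD:K3 hand-off to cell
`bsd-ssimc`, last generation before the D-0075 sunset). This file books nothing and moves no mark; X7 / X8 stay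
CONSTRUCTION-SHAPED; C-16 = CONJECTURE. NO Euler system is asserted to exist (binder `hc`).

## What this file does

F31/F31b/F32 (`KolyvaginKimDatumOfEulerSystem[Letter|AnyPrime].lean`) compose C-16's chain with n1011's THEOREM D on the rows
where every bad place `w ≠ p` has `E(ℚ_w)[p] = 0` (certificate `hbad`). Team n1011's `GaloisImage/KolyvaginSystemOfEulerSystemPropagatedBad.lean`
(`Derivative.Rat.exists_isKolyvaginSystem_propagatedSelmerStructure_of_primes''`) serves the complementary rows — those WITH an anomalous
bad place — by restricting the Kolyvagin primes instead: `hP''`, "`p ∤ ord(w mod q)` for every `q ∈ 𝒫` and every anomalous bad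
`w ≠ p`" (ROUTE-1 §43.5 / §45.4, positive Chebotarev density). This file is the corresponding composition:

* §1 **`kolyvaginKimDatum_of_isEulerSystem_of_primes''`** — any odd `p`: `KolyvaginKimDatum W f p ℓ k₀ (k+1) Q vℓ vp ψ` from an Euler
  system of `T_pE` over the cyclotomic levels + THEOREM D″'s binders (`Irr(E[p])`, THE CANONICAL datum, `hP''`, `htop`) + F30's
  binders + ONE reading hypothesis on every derived system; the coefficient system `E[p^{k+1}]_{ℤ_p}` is instantiated here
  exactly as in n1011's D6 (`tateModuleRed`, the inclusions along `geomTorsion_pow_succ_eq`, `hcomp` by `rfl`).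
* §2 **`kuriharaExactOrderAt_of_isEulerSystem_of_primes''_letter`** — `p = 3`, C-16's clause at `(ℓ, k₀)` on its letter with
  `htop` DISCHARGED from the letter (F31b's `E(ℚ_v)[3] = 0` + n1011's F11/F12) and `hP''` carried inside the per-`ψ` data.
  Together with F31b's `…_torsionCoeff_letter` every curve on the letter is served by one of the two THEOREM D variants
  (the second for `ℓ` prime to the orders `ord(w mod ℓ)`... precisely: with `3 ∤ ord(w mod ℓ)` at the anomalous bad `w`).

References: B. Mazur, K. Rubin, Mem. AMS 799 (2004), Def. 3.2.1, Thm. 3.2.4, Thm. 5.2.12, App. A [MazurRubin2004]; K. Rubin,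
*Euler Systems* (2000) Thm. 4.5.1 [Rubin2000]; R. Sakamoto, JTNB 36 (2024) §2, Def. 4.1 [Sakamoto2024]; C.-H. Kim,
arXiv:2203.12159, Thm. 3.13, (5.3) [Kim2022StructureSelmer]; J. S. Milne, ADT (2006) I 2.8, 4.10(b) [MilneADT2006];
J. H. Silverman, AEC (2009) IV.6.1, VII.2.1 [SilvermanAEC2009].
-/

noncomputable section

open CategoryTheory Function Finset Field IsDedekindDomain
open scoped NumberField Classical ContRepresentation MatrixGroups
open CongruenceSubgroup WeierstrassCurve Literature.NumberTheory.EllipticCurves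
  Literature.NumberTheory.EllipticCurves.ModularForms
  Literature.NumberTheory.EllipticCurves.Rank1Residual
  Literature.NumberTheory.GaloisRepresentations Literature.NumberTheory.GaloisCohomology
  Literature.NumberTheory.GaloisRepresentations.DiscreteGaloisModule
  NumberField
  Summit.BirchSwinnertonDyer.Rank1Residual.GaloisImage
  Summit.BirchSwinnertonDyer.Rank1Residual.GaloisImage.CoeffTransport
  Summit.BirchSwinnertonDyer.Rank1Residual.GaloisImage.CyclotomicLevel
  Summit.BirchSwinnertonDyer.Rank1Residual.GaloisImage.TorsionCoeff
  Rat.HeightOneSpectrum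

namespace Summit.BirchSwinnertonDyer.Rank1Residual.Ordinary

variable (W : WeierstrassCurve ℚ) [W.IsElliptic] [W.IsGloballyMinimal]

/-! ### §1 The datum from an Euler system of `T_pE` under `𝒫″` (any odd `p`) -/

section Generic

variable (p : ℕ) [hp : Fact p.Prime]
variable [Module.Free ℤ_[p] (W.tateModule p)] [Module.Finite ℤ_[p] (W.tateModule p)]
  [ContinuousSMul ℤ_[p] (W.tateModule p)]

/-- Local notation: `T∞ = T_p E` as a continuous `G_ℚ`-representation (as in n1011's THEOREM D files). -/
local notation3 "T∞" => WeierstrassCurve.tateGaloisRep W p (W.continuous_galoisRepTate_holds p)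

variable (S : Set (HeightOneSpectrum (𝓞 ℚ)))

/-- Local notation: `𝓛` = the cyclotomic Euler-system levels `ℚ(μ_{p^{n+1}}, μ_r)`, `r ∩ S = ∅`. -/
local notation3 "𝓛" => cyclotomicLevelsRat p S

/-- Local notation: `𝐃ℤ⟦X, U, τ⟧ ℓ = ∑_{j < ℓ−1} j·(τ_ℓ)_*^j` on `H¹(U, X)` (`ℤ`-linear), Kolyvagin's derivative operator. -/
local notation3 (prettyPrint := false) "𝐃ℤ⟦" X ", " U ", " τ "⟧" =>
  fun ℓ : HeightOneSpectrum (𝓞 ℚ) =>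
  ∑ j ∈ Finset.range (((primesEquiv ℓ : Nat.Primes) : ℕ) - 1),
    (j : Module.End ℤ (continuousCohomology 1 (subgroupRep X U))) *
      (conjMap X U ((τ : HeightOneSpectrum (𝓞 ℚ) → absoluteGaloisGroup ℚ) ℓ) 1).hom.toLinearMap ^ j

/-- Local notation: the level-`j` reduction `red_j : T_pE ⟶ E[p^j]_{ℤ_p}` (n1011 GZ-2). -/
local notation3 "𝐫𝐞𝐝⟦" j "⟧" => tateModuleRed W p (W.continuous_galoisRepTate_holds p) j

variable {N : ℕ} (f : CuspForm (Gamma0 N) 2) (ℓ k₀ k : ℕ) [Fact ℓ.Prime] (Q : W.toAffine.Point)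
  (vℓ vp : HeightOneSpectrum (𝓞 ℚ)) (ψ : (q : ℕ) → (ZMod q)ˣ →* Multiplicative (ZMod (p ^ k₀)))

/-- **`KolyvaginKimDatum` at depth `k + 1` (any odd `p`) from an EULER SYSTEM of `T_pE` on the rows WITH ANOMALOUS BAD PLACES allowed**
(n1011's THEOREM D variant `Derivative.Rat.exists_isKolyvaginSystem_propagatedSelmerStructure_of_primes''`,
`GaloisImage/KolyvaginSystemOfEulerSystemPropagatedBad.lean`, instantiated with the coefficients `E[p^{k+1}]_{ℤ_p}` exactly as their D6):
the row certificate `hbad` of F31/F32 is REPLACED by the prime-set condition `hP''` — every Kolyvagin prime `q ∈ 𝒫` has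
`p ∤ ord(w mod q)` for every bad `w ≠ p` carrying a non-zero `p`-torsion point over `ℚ_w` (ROUTE-1's `𝒫″`, positive density) —;
the place `p` stays the displayed certificate `htop` (`𝓕_can,p = ⊤`); the other binders and the ONE reading hypothesis `hread` on
every derived system are those of `kolyvaginKimDatum_of_isEulerSystem_torsionCoeff_prime` (F32). Proof: THEOREM D″ ∘ `hread` ∘ F30.
[cite: MazurRubin2004, Thm. 3.2.4, Thm. 5.2.12 and App. A] [cite: Rubin2000, Thm. 4.5.1] [cite: Kim2022StructureSelmer, Thm. 3.13 and (5.3)]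
[cite: Sakamoto2024, §2 (p. 921) and Def. 4.1 (p. 926)] -/
theorem kolyvaginKimDatum_of_isEulerSystem_of_primes'' (hp2 : p ≠ 2)
    -- the Euler system and THEOREM D's binders
    {c : ∀ (i : ℕ) (r : (𝓛).Ideals), H1 T∞ ((𝓛).level i r.1)}
    (hc : IsEulerSystem 𝓛 T∞ p c) (hirr : W.HasIrreducibleModPGaloisRep p)
    (D : KolyvaginDatum (W.torsionGaloisModule ((p : ℤ) ^ k * (p : ℤ))))
    (hT : D.transverse = cyclotomicTransverse (W.torsionGaloisModule ((p : ℤ) ^ k * (p : ℤ))))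
    {η : (q : HeightOneSpectrum (𝓞 ℚ)) → (ZMod (Ideal.absNorm q.asIdeal))ˣ}
    (hD : D.HasCanonicalComparison (p ^ (k + 1)) η)
    (hPr : D.primes ⊆ (𝓛).primes)
    (hKol : ∀ q ∈ D.primes, Kato.IsKolyvaginPrime W p (k + 1) ((primesEquiv q : Nat.Primes) : ℕ))
    (hP'' : ∀ q ∈ D.primes, ∀ w : HeightOneSpectrum (𝓞 ℚ), ¬ W.HasGoodReductionAt w →
      ((primesEquiv w : Nat.Primes) : ℕ) ≠ p →
      (∃ P : (W.baseChange (w.adicCompletion ℚ)).toAffine.Point, p • P = 0 ∧ P ≠ 0) →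
        ¬ p ∣ orderOf ((((primesEquiv w : Nat.Primes) : ℕ) : ZMod ((primesEquiv q : Nat.Primes) : ℕ))))
    (htop : ∀ w : HeightOneSpectrum (𝓞 ℚ), ((primesEquiv w : Nat.Primes) : ℕ) = p →
      propagatedSelmerStructure W p k (Sum.inr w) = ⊤)
    -- F30's binders: Sakamoto's `τ`-class for the canonical datum, the place `vℓ`, the divisibility witness
    (Sτ : Set (HeightOneSpectrum (𝓞 ℚ))) {τ : absoluteGaloisGroup ℚ}
    (hτq : Nonempty (cokerSubOne (W.torsionGaloisModule ((p : ℤ) ^ k * (p : ℤ))) τ ≃+ ZMod (p ^ (k + 1))))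
    (hτμ : τ ∈ rootsOfUnityFixer ℚ (p ^ (k + 1)))
    (hP : D.primes ⊆ frobeniusClassPrimes (W.torsionGaloisModule ((p : ℤ) ^ k * (p : ℤ))) Sτ τ (p ^ (k + 1)))
    (hDℓ : vℓ ∈ D.primes)
    (hdiv : ∀ X : geomPoints W, ∃ R : geomPoints W, ((p : ℤ) ^ k * (p : ℤ)) • R = X)
    (hpv : ((p : ℕ) : 𝓞 ℚ) ∉ vℓ.asIdeal) (hgood : W.HasGoodReductionAt vℓ) (hvp : ((p : ℕ) : 𝓞 ℚ) ∈ vp.asIdeal)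
    -- the two READINGS of the derived system: bottom class (MR Thm. 5.2.12) and Kim's reading (Thm. 3.13 + (5.3))
    (hread : letI := TorsionCoeff.torsionBy.padicIntModule p (k + 1) (WeierstrassCurve.geomPoints W)
      ∀ (σ : HeightOneSpectrum (𝓞 ℚ) → absoluteGaloisGroup ℚ)
        (Φ : ∀ r : Finset (HeightOneSpectrum (𝓞 ℚ)),
          continuousCohomology 1 (subgroupRep (torsionRepPadicInt W p (k + 1)).toTopRep ((𝓛).level ⊥ r)) →+
            continuousCohomology 1 (subgroupRep
              (W.torsionGaloisModule ((p : ℤ) ^ k * (p : ℤ))).toTopRep ((𝓛).level ⊥ r)))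
        (comm : ∀ r : Finset (HeightOneSpectrum (𝓞 ℚ)),
          ((r : Finset _) : Set (HeightOneSpectrum (𝓞 ℚ))).Pairwise fun a b =>
            Commute (𝐃ℤ⟦(W.torsionGaloisModule ((p : ℤ) ^ k * (p : ℤ))).toTopRep, ((𝓛).level ⊥ r), σ⟧ a)
              (𝐃ℤ⟦(W.torsionGaloisModule ((p : ℤ) ^ k * (p : ℤ))).toTopRep, ((𝓛).level ⊥ r), σ⟧ b))
        (κ : Finset (HeightOneSpectrum (𝓞 ℚ)) →
          galoisCohomology (W.torsionGaloisModule ((p : ℤ) ^ k * (p : ℤ))) 1),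
        (∀ q, σ q ∈ (adicCompletionPrime ℚ q).inertia (absoluteGaloisGroup ℚ)) →
        (∀ q, modNCyclotomicCharacter ℚ (Ideal.absNorm q.asIdeal) (σ q) = η q) →
        (∀ r, ∀ (φ : contOneCocycles (subgroupRep (torsionRepPadicInt W p (k + 1)).toTopRep ((𝓛).level ⊥ r)))
          (ψ' : contOneCocycles (subgroupRep
            (W.torsionGaloisModule ((p : ℤ) ^ k * (p : ℤ))).toTopRep ((𝓛).level ⊥ r))),
          (∀ g, ψ'.1 g = AddSubgroup.inclusion (geomTorsion_pow_succ_eq W p k).le (φ.1 g)) →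
            Φ r (oneCocycleClass _ φ) = oneCocycleClass _ ψ') →
        D.IsKolyvaginSystem (propagatedSelmerStructure W p k) κ →
        (∀ r : Finset (HeightOneSpectrum (𝓞 ℚ)), ¬ (↑r : Set _) ⊆ D.primes → κ r = 0) →
        (∀ (r : Finset (HeightOneSpectrum (𝓞 ℚ))) (hr : (↑r : Set _) ⊆ D.primes),
          resSubgroup (W.torsionGaloisModule ((p : ℤ) ^ k * (p : ℤ))).toTopRep ((𝓛).level ⊥ r) 1
              (κ r) =
            (r.noncommProd 𝐃ℤ⟦(W.torsionGaloisModule ((p : ℤ) ^ k * (p : ℤ))).toTopRep,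
                ((𝓛).level ⊥ r), σ⟧ (comm r))
              (Φ r (ContinuousCohomology.map (ContinuousMonoidHom.id _)
                (X := subgroupRep T∞.toTopRep ((𝓛).level ⊥ r))
                (Y := subgroupRep (torsionRepPadicInt W p (k + 1)).toTopRep ((𝓛).level ⊥ r))
                ((TopRep.resFunctor ((𝓛).level ⊥ r).subtype).map 𝐫𝐞𝐝⟦k + 1⟧) 1
                (c ⊥ ⟨r, fun _ hq => hPr (hr (Finset.mem_coe.2 hq))⟩)))) →
        κ ∅ = kummerMapTorsion W ((p : ℤ) ^ k * (p : ℤ)) hdiv Q ∧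
        ∀ ψp : galoisCohomology ((W.torsionGaloisModule ((p : ℤ) ^ k * (p : ℤ))).toLocal (Sum.inr vp)) 1 ⧸
            W.kummerSelmerStructure ((p : ℤ) ^ k * (p : ℤ)) (Sum.inr vp) ≃+ ZMod (p ^ (k + 1)),
          (haveI : NeZero ℓ := ⟨(Fact.out : ℓ.Prime).ne_zero⟩
           zmodPowOrd p k₀ (kuriharaNumber f (p ^ k₀) ℓ ψ)) =
            min k₀ (zmodPowOrd p (k + 1)
              (ψp (galoisCohomology.localization (W.torsionGaloisModule ((p : ℤ) ^ k * (p : ℤ)))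
                (Sum.inr vp) 1 (κ {vℓ}))))) :
    KolyvaginKimDatum W f p ℓ k₀ (k + 1) Q vℓ vp ψ := by
  letI := TorsionCoeff.torsionBy.padicIntModule p (k + 1) (WeierstrassCurve.geomPoints W)
  have hred : Function.Surjective (𝐫𝐞𝐝⟦k + 1⟧).hom := by
    intro y
    obtain ⟨a, ha⟩ := W.proj_surjective_of_isAlgClosed_holds p (k + 1) y.2
    exact ⟨a, Subtype.ext ha⟩
  obtain ⟨σ, Φ, comm, κ, hσI, hσχ, hΦ, hKS, hκ0, hκc⟩ :=
    Derivative.Rat.exists_isKolyvaginSystem_propagatedSelmerStructure_of_primes'' W p S hp2 hc 𝐫𝐞𝐝⟦k + 1⟧ hred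
      (fun m => pow_smul_eq_zero p (k + 1) _ m)
      (AddSubgroup.inclusion (geomTorsion_pow_succ_eq W p k).le : _ →+ _) continuous_of_discreteTopology
      (fun _ _ => rfl) (AddSubgroup.inclusion (geomTorsion_pow_succ_eq W p k).ge : _ →+ _)
      continuous_of_discreteTopology (fun x => Subtype.ext rfl) (fun y => Subtype.ext rfl)
      (fun _ => Subtype.ext rfl) hirr D hT hD hPr hKol hP'' htop
  obtain ⟨h1, hkim⟩ := hread σ Φ comm κ hσI hσχ hΦ hKS hκ0 hκc
  exact kolyvaginKimDatum_of_isKolyvaginSystem_canonicalStructure W f p ℓ k₀ k Q vℓ vp ψ hp2 Sτ hτq hτμ hP hD hDℓ hdiv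
    hpv hgood hvp hKS h1 hkim

end Generic

/-! ### §2 `p = 3`: C-16's clause on its letter, rows WITH anomalous bad places, `htop` discharged from the letter -/

section Three

variable [Module.Free ℤ_[3] (W.tateModule 3)] [Module.Finite ℤ_[3] (W.tateModule 3)]
  [ContinuousSMul ℤ_[3] (W.tateModule 3)]

/-- Local notation: `𝐃ℤ₃⟦X, U, τ⟧ ℓ`, Kolyvagin's derivative operator (`ℤ`-linear) — the `p = 3` copy of §1's notation. -/
local notation3 (prettyPrint := false) "𝐃ℤ₃⟦" X ", " U ", " τ "⟧" =>
  fun ℓ : HeightOneSpectrum (𝓞 ℚ) =>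
  ∑ j ∈ Finset.range (((primesEquiv ℓ : Nat.Primes) : ℕ) - 1),
    (j : Module.End ℤ (continuousCohomology 1 (subgroupRep X U))) *
      (conjMap X U ((τ : HeightOneSpectrum (𝓞 ℚ) → absoluteGaloisGroup ℚ) ℓ) 1).hom.toLinearMap ^ j

variable {N : ℕ} (f : CuspForm (Gamma0 N) 2) (ℓ k₀ : ℕ) [Fact ℓ.Prime] (P : W.toAffine.Point) (F : ℕ)

/-- **C-16's clause at `(ℓ, k₀)` ON ITS LETTER from an Euler system of `T_3E`, rows WITH anomalous bad places** — the companion of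
F31b's `kuriharaExactOrderAt_of_isEulerSystem_torsionCoeff_letter`: THEOREM D's certificate `hbad` is replaced by the prime-set
condition `hP''` on the canonical datum's primes (inside the per-`ψ` data, next to `vℓ ∈ 𝒫`: it is a condition on the letter's
`ℓ` relative to the anomalous bad places of `E`), the place-`3` certificate `htop` is DISCHARGED from the letter (`3` good,
`a₃ ∉ {1, −2}` ⟹ `E(ℚ_v)[3] = 0` at `v ∣ 3`, F31b, ⟹ `𝓕_can,3 = ⊤` by n1011's F11/F12
`propagatedSelmerStructure_three_eq_top_of_torsion_eq_zero` with the reduction maps `rd`), and `Irr(E[3])` from surj(3). Remaining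
curve-level binder: the reduction maps `rd`/`hrd`. With F31b this covers EVERY curve on C-16's letter: by `…_torsionCoeff_letter`
when no bad place carries `ℚ_w`-rational `3`-torsion, by this theorem otherwise (for `ℓ` with `3 ∤ ord(w mod ℓ)` at those places).
Nothing asserted; C-16 stays a CONJECTURE. [cite: MazurRubin2004, Thm. 3.2.4, Thm. 5.2.12 and App. A]
[cite: Rubin2000, Thm. 4.5.1] [cite: Kim2022StructureSelmer, Thm. 3.13 and (5.3)] [cite: MilneADT2006, Ch. I, Thm. 4.10(b) and Thm. 2.8]
[cite: SilvermanAEC2009, IV.6.1 and Prop. VII.2.1] -/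
theorem kuriharaExactOrderAt_of_isEulerSystem_of_primes''_letter
    (hgood : W.HasGoodReductionAtPrime 3) (ha1 : W.frobeniusTrace 3 ≠ 1) (ha2 : W.frobeniusTrace 3 ≠ -2)
    (hm0 : ¬ O5.PointLocallyThreeDivisibleAt W 3 P) (hcycℓ : IsCyclicKolyvaginLevel W 3 ℓ)
    {vℓ v₃ : HeightOneSpectrum (𝓞 ℚ)} (hvℓ : (ℓ : 𝓞 ℚ) ∈ vℓ.asIdeal) (hv₃ : ((3 : ℕ) : 𝓞 ℚ) ∈ v₃.asIdeal)
    (hPT : poitouTate_sum_localTatePairing_eq_zero ℚ)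
    (hEPℓ : localEulerPoincareCharacteristic (vℓ.adicCompletion ℚ))
    (hEP₃ : localEulerPoincareCharacteristic (v₃.adicCompletion ℚ))
    -- curve-level inputs of THEOREM D: `Irr(E[3])` from surj(3); the reduction maps `rd` (for F11/F12) DISPLAYED
    (hsurj : W.HasSurjectiveModNGaloisRep ((3 : ℕ) : ℤ))
    (rd : ∀ j : ℕ, (W.torsionGaloisModule (((3 : ℕ) : ℤ) ^ (j + 1) * ((3 : ℕ) : ℤ))).toContRepresentation →ⁱL
      (W.torsionGaloisModule (((3 : ℕ) : ℤ) ^ j * ((3 : ℕ) : ℤ))).toContRepresentation)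
    (hrd : ∀ (j : ℕ) (x : geomTorsion W (((3 : ℕ) : ℤ) ^ (j + 1) * ((3 : ℕ) : ℤ))),
      ((rd j x : geomTorsion W (((3 : ℕ) : ℤ) ^ j * ((3 : ℕ) : ℤ))) : geomPoints W) =
        ((3 : ℕ) : ℤ) • (x : geomPoints W))
    -- per surjective `ψ`: the depth, the unit, the Euler system, the canonical datum, the readings
    (h : ∀ ψ : (q : ℕ) → (ZMod q)ˣ →* Multiplicative (ZMod (3 ^ k₀)),
      (∀ q ∈ ℓ.primeFactors, Function.Surjective (ψ q)) →
        ∃ (k : ℕ) (_ : k₀ ≤ k + 1) (_ : Kato.IsKolyvaginPrime W 3 (k + 1) ℓ) (u : ℕ) (_ : ¬ 3 ∣ u)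
          (S : Set (HeightOneSpectrum (𝓞 ℚ)))
          (c : ∀ (i : ℕ) (r : (cyclotomicLevelsRat 3 S).Ideals),
            H1 (WeierstrassCurve.tateGaloisRep W 3 (W.continuous_galoisRepTate_holds 3))
              ((cyclotomicLevelsRat 3 S).level i r.1))
          (_ : IsEulerSystem (cyclotomicLevelsRat 3 S)
            (WeierstrassCurve.tateGaloisRep W 3 (W.continuous_galoisRepTate_holds 3)) 3 c)
          (D : KolyvaginDatum (W.torsionGaloisModule (((3 : ℕ) : ℤ) ^ k * ((3 : ℕ) : ℤ))))
          (_ : D.transverse = cyclotomicTransverse (W.torsionGaloisModule (((3 : ℕ) : ℤ) ^ k * ((3 : ℕ) : ℤ))))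
          (η : (q : HeightOneSpectrum (𝓞 ℚ)) → (ZMod (Ideal.absNorm q.asIdeal))ˣ)
          (_ : D.HasCanonicalComparison (3 ^ (k + 1)) η)
          (hPr : D.primes ⊆ (cyclotomicLevelsRat 3 S).primes)
          (_ : ∀ q ∈ D.primes, Kato.IsKolyvaginPrime W 3 (k + 1) ((primesEquiv q : Nat.Primes) : ℕ))
          (_ : ∀ q ∈ D.primes, ∀ w : HeightOneSpectrum (𝓞 ℚ), ¬ W.HasGoodReductionAt w →
            ((primesEquiv w : Nat.Primes) : ℕ) ≠ 3 →
            (∃ P : (W.baseChange (w.adicCompletion ℚ)).toAffine.Point, 3 • P = 0 ∧ P ≠ 0) →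
              ¬ 3 ∣ orderOf ((((primesEquiv w : Nat.Primes) : ℕ) : ZMod ((primesEquiv q : Nat.Primes) : ℕ))))
          (Sτ : Set (HeightOneSpectrum (𝓞 ℚ))) (τ : absoluteGaloisGroup ℚ)
          (_ : Nonempty (cokerSubOne (W.torsionGaloisModule (((3 : ℕ) : ℤ) ^ k * ((3 : ℕ) : ℤ))) τ ≃+
            ZMod (3 ^ (k + 1))))
          (_ : τ ∈ rootsOfUnityFixer ℚ (3 ^ (k + 1)))
          (_ : D.primes ⊆ frobeniusClassPrimes (W.torsionGaloisModule (((3 : ℕ) : ℤ) ^ k * ((3 : ℕ) : ℤ))) Sτ τ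
            (3 ^ (k + 1)))
          (_ : vℓ ∈ D.primes)
          (hdiv : ∀ X : geomPoints W, ∃ R : geomPoints W, (((3 : ℕ) : ℤ) ^ k * ((3 : ℕ) : ℤ)) • R = X),
          (letI := TorsionCoeff.torsionBy.padicIntModule 3 (k + 1) (WeierstrassCurve.geomPoints W)
            ∀ (σ : HeightOneSpectrum (𝓞 ℚ) → absoluteGaloisGroup ℚ)
              (Φ : ∀ r : Finset (HeightOneSpectrum (𝓞 ℚ)),
                continuousCohomology 1 (subgroupRep (torsionRepPadicInt W 3 (k + 1)).toTopRep
                  ((cyclotomicLevelsRat 3 S).level ⊥ r)) →+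
                  continuousCohomology 1 (subgroupRep
                    (W.torsionGaloisModule (((3 : ℕ) : ℤ) ^ k * ((3 : ℕ) : ℤ))).toTopRep
                    ((cyclotomicLevelsRat 3 S).level ⊥ r)))
              (comm : ∀ r : Finset (HeightOneSpectrum (𝓞 ℚ)),
                ((r : Finset _) : Set (HeightOneSpectrum (𝓞 ℚ))).Pairwise fun a b =>
                  Commute
                    (𝐃ℤ₃⟦(W.torsionGaloisModule (((3 : ℕ) : ℤ) ^ k * ((3 : ℕ) : ℤ))).toTopRep,
                      ((cyclotomicLevelsRat 3 S).level ⊥ r), σ⟧ a)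
                    (𝐃ℤ₃⟦(W.torsionGaloisModule (((3 : ℕ) : ℤ) ^ k * ((3 : ℕ) : ℤ))).toTopRep,
                      ((cyclotomicLevelsRat 3 S).level ⊥ r), σ⟧ b))
              (κ : Finset (HeightOneSpectrum (𝓞 ℚ)) →
                galoisCohomology (W.torsionGaloisModule (((3 : ℕ) : ℤ) ^ k * ((3 : ℕ) : ℤ))) 1),
              (∀ q, σ q ∈ (adicCompletionPrime ℚ q).inertia (absoluteGaloisGroup ℚ)) →
              (∀ q, modNCyclotomicCharacter ℚ (Ideal.absNorm q.asIdeal) (σ q) = η q) →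
              (∀ r, ∀ (φ : contOneCocycles (subgroupRep (torsionRepPadicInt W 3 (k + 1)).toTopRep
                  ((cyclotomicLevelsRat 3 S).level ⊥ r)))
                (ψ' : contOneCocycles (subgroupRep
                  (W.torsionGaloisModule (((3 : ℕ) : ℤ) ^ k * ((3 : ℕ) : ℤ))).toTopRep
                  ((cyclotomicLevelsRat 3 S).level ⊥ r))),
                (∀ g, ψ'.1 g = AddSubgroup.inclusion (geomTorsion_pow_succ_eq W 3 k).le (φ.1 g)) →
                  Φ r (oneCocycleClass _ φ) = oneCocycleClass _ ψ') →
              D.IsKolyvaginSystem (propagatedSelmerStructure W 3 k) κ →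
              (∀ r : Finset (HeightOneSpectrum (𝓞 ℚ)), ¬ (↑r : Set _) ⊆ D.primes → κ r = 0) →
              (∀ (r : Finset (HeightOneSpectrum (𝓞 ℚ))) (hr : (↑r : Set _) ⊆ D.primes),
                resSubgroup (W.torsionGaloisModule (((3 : ℕ) : ℤ) ^ k * ((3 : ℕ) : ℤ))).toTopRep
                    ((cyclotomicLevelsRat 3 S).level ⊥ r) 1 (κ r) =
                  (r.noncommProd 𝐃ℤ₃⟦(W.torsionGaloisModule (((3 : ℕ) : ℤ) ^ k * ((3 : ℕ) : ℤ))).toTopRep,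
                      ((cyclotomicLevelsRat 3 S).level ⊥ r), σ⟧ (comm r))
                    (Φ r (ContinuousCohomology.map (ContinuousMonoidHom.id _)
                      (X := subgroupRep
                        (WeierstrassCurve.tateGaloisRep W 3 (W.continuous_galoisRepTate_holds 3)).toTopRep
                        ((cyclotomicLevelsRat 3 S).level ⊥ r))
                      (Y := subgroupRep (torsionRepPadicInt W 3 (k + 1)).toTopRep
                        ((cyclotomicLevelsRat 3 S).level ⊥ r))
                      ((TopRep.resFunctor ((cyclotomicLevelsRat 3 S).level ⊥ r).subtype).map
                        (tateModuleRed W 3 (W.continuous_galoisRepTate_holds 3) (k + 1))) 1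
                      (c ⊥ ⟨r, fun _ hq => hPr (hr (Finset.mem_coe.2 hq))⟩)))) →
              κ ∅ = kummerMapTorsion W (((3 : ℕ) : ℤ) ^ k * ((3 : ℕ) : ℤ)) hdiv ((3 ^ F * u) • P) ∧
              ∀ ψp : galoisCohomology ((W.torsionGaloisModule (((3 : ℕ) : ℤ) ^ k * ((3 : ℕ) : ℤ))).toLocal
                    (Sum.inr v₃)) 1 ⧸
                  W.kummerSelmerStructure (((3 : ℕ) : ℤ) ^ k * ((3 : ℕ) : ℤ)) (Sum.inr v₃) ≃+ ZMod (3 ^ (k + 1)),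
                (haveI : NeZero ℓ := ⟨(Fact.out : ℓ.Prime).ne_zero⟩
                 zmodPowOrd 3 k₀ (kuriharaNumber f (3 ^ k₀) ℓ ψ)) =
                  min k₀ (zmodPowOrd 3 (k + 1)
                    (ψp (galoisCohomology.localization (W.torsionGaloisModule (((3 : ℕ) : ℤ) ^ k * ((3 : ℕ) : ℤ)))
                      (Sum.inr v₃) 1 (κ {vℓ})))))) :
    KuriharaExactOrderAt W f ℓ k₀ P F := by
  have hirr : W.HasIrreducibleModPGaloisRep 3 := hasIrreducibleModPGaloisRep_of_hasSurjectiveModNGaloisRep W 3 hsurj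
  have htors₃ := forall_three_nsmul_eq_zero_adicCompletion_of_frobeniusTrace_three W hgood ha1 ha2
  refine kuriharaExactOrderAt_of_kolyvaginKimDatum W f ℓ k₀ P F hgood ha1 ha2 hm0 hcycℓ hvℓ hv₃ hPT hEPℓ hEP₃
    fun ψ hψ => ?_
  obtain ⟨k, hk, hKP, u, hu, S, c, hc, D, hT, η, hD, hPr, hKol, hP'', Sτ, τ, hτq, hτμ, hP, hDℓ, hdiv, hread⟩ := h ψ hψ
  obtain ⟨hpv, hgoodℓ⟩ := IsKolyvaginPrime.not_mem_and_hasGoodReductionAt W hKP hvℓ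
  have htop : ∀ w : HeightOneSpectrum (𝓞 ℚ), ((primesEquiv w : Nat.Primes) : ℕ) = 3 →
      propagatedSelmerStructure W 3 k (Sum.inr w) = ⊤ := fun w hw3 => by
    have hv : ((3 : ℕ) : 𝓞 ℚ) ∈ w.asIdeal :=
      (natCast_mem_asIdeal_iff_eq_primesEquiv_symm w Nat.prime_three).mpr
        (primesEquiv.injective (by rw [Equiv.apply_symm_apply]; exact Subtype.ext hw3))
    exact propagatedSelmerStructure_three_eq_top_of_torsion_eq_zero W w hv (htors₃ w hv) rd hrd k
  exact ⟨k + 1, hk, hKP, u, hu, kolyvaginKimDatum_of_isEulerSystem_of_primes'' W 3 S f ℓ k₀ k _ vℓ v₃ ψ (by decide) hc hirr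
    D hT hD hPr hKol hP'' htop Sτ hτq hτμ hP hDℓ hdiv hpv hgoodℓ hv₃ hread⟩

end Three

end Summit.BirchSwinnertonDyer.Rank1Residual.Ordinary

end
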